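import Summits.BirchSwinnertonDyer.BirchSwinnertonDyer.Theses.ResidualThetaTransportAtTwo
import Literature.NumberTheory.EllipticCurves.SupersingularModPDecompositionImageProofs
import HarnessLib

/-!
# The PUB⁵ bundle `PublishedInputsHeckeAtTwo` (stmt-BirchSwinnertonDyer-27435) FROM FOUR print facts:
# its Serre 1972 conjunct is now a tree THEOREM (`serre1972_supersingular_decompositionSubgroup_image_holds`)
# and the single-fact alias item stmt-BirchSwinnertonDyer-27793 `SerreSupersingularDecompositionImageInput` BY NAME
# (width seat bsd-tp2-w8 g0, literature-prover; `--supports stmt-BirchSwinnertonDyer-27435`; composition only)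
#
# Filed for the author by the INPUTS desk's idle prover `bsd-inputs-honda-p1` g13 (plan-1 DELTA-11 §4 (ii)); text = the author's
# `pub/bsd-wall/bsd-tp2-w8/ThetaPartnerAtTwoPublishedInputsHeckeAtTwoOfFourFacts.lean` (sha16 c6f50ed0a323d281) minus the two
# item-27793 closers already landed in `Theorems/ThetaPartnerAtTwoSerreSupersingularDecompositionImageInput.lean` (gate dedup).

HONEST FRAMING. THEOREMS ONLY. The HOLD item `PublishedInputsHeckeAtTwo` (shared by the routes
ThetaPartnerAtTwo and ResidualThetaTransportAtTwo: the two Theses files each carry a copy of the `def`)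
is the conjunction ES ∧ SD ∧ Bz ∧ Se ∧ AU of five named Literature facts. Of these, Se =
`Literature.NumberTheory.EllipticCurves.serre1972_supersingular_decompositionSubgroup_image`
(Serre 1972, §1.11 Prop. 12 (c),(d) over `ℚ`) is DISCHARGED in the tree
(`Literature/NumberTheory/EllipticCurves/SupersingularModPDecompositionImageProofs.lean`); the other
four — Eichler–Shimura period lattice of the depleted optimal quotient (ES), Hecke self-duality of
`J₀(N)`-torsion (SD), Buzzard 2000 mod-`2` multiplicity one (Bz), Abbes–Ullmo Thm. A (AU) — remain
HYPOTHESES (cite-only, unproved in the tree). So every statement below is conditional on exactly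
{ES, SD, Bz, AU}: the item is REDUCED from PUB⁵ to PUB⁴ by name; it is NOT closed. BSD is not proved
by any of this.

References: J.-P. Serre, Invent. Math. 15 (1972) §1.11 Prop. 12, §2.2; K. Buzzard, MRL 7 (2000)
Prop. 2.4; A. Abbes, E. Ullmo, Compositio Math. 103 (1996) Thm. A; H. Darmon, F. Diamond, R. Taylor,
*Fermat's Last Theorem* (1995) Lemma 1.38; A. Agashe, K. Ribet, W. Stein, PAMQ 2 (2006) §3.
-/

-- justification: the `Summit.BirchSwinnertonDyer.BirchSwinnertonDyer.…` path repeats a component (route-file convention)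
set_option linter.dupNamespace false
set_option autoImplicit false

noncomputable section

open Literature.NumberTheory.EllipticCurves Literature.NumberTheory.EllipticCurves.ModularForms

namespace Summit.BirchSwinnertonDyer.BirchSwinnertonDyer.Theorems.PublishedInputsHeckeAtTwo

/-- **PUB⁴ ⟹ PUB⁵ (route ThetaPartnerAtTwo)**: `PublishedInputsHeckeAtTwo` from Eichler–Shimura
(depleted optimal quotient), Hecke self-duality, Buzzard 2000 and Abbes–Ullmo Thm. A — the Serre 1972
conjunct is supplied by the tree theorem `serre1972_supersingular_decompositionSubgroup_image_holds`.
[cite: SerreInventiones1972, §1.11 Prop. 12 (c),(d); §2.2] -/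
theorem thetaPartner_of_esSdBzAu
    (hES : eichlerShimura_depletedOptimalQuotient_periodLattice_of_dvd) (hSD : heckeSelfDual_torsionBy_J0)
    (hBz : buzzard2000_multiplicityOne_gamma0)
    (hAU : abbesUllmo_not_dvd_maninConstant_of_not_dvd_level) :
    Summit.BirchSwinnertonDyer.BirchSwinnertonDyer.Theses.ThetaPartnerAtTwo.PublishedInputsHeckeAtTwo :=
  ⟨hES, hSD, hBz, serre1972_supersingular_decompositionSubgroup_image_holds, hAU⟩

/-- **PUB⁵ ⟺ PUB⁴ (route ThetaPartnerAtTwo)**: the HOLD bundle is EQUIVALENT to the conjunction of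
its four unproved conjuncts ES ∧ SD ∧ Bz ∧ AU. [cite: SerreInventiones1972, §1.11 Prop. 12 (c),(d); §2.2] -/
theorem thetaPartner_iff_esSdBzAu :
    Summit.BirchSwinnertonDyer.BirchSwinnertonDyer.Theses.ThetaPartnerAtTwo.PublishedInputsHeckeAtTwo ↔
      eichlerShimura_depletedOptimalQuotient_periodLattice_of_dvd ∧ heckeSelfDual_torsionBy_J0 ∧
        buzzard2000_multiplicityOne_gamma0 ∧ abbesUllmo_not_dvd_maninConstant_of_not_dvd_level :=
  ⟨fun h ↦ ⟨h.1, h.2.1, h.2.2.1, h.2.2.2.2⟩,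
    fun h ↦ thetaPartner_of_esSdBzAu h.1 h.2.1 h.2.2.1 h.2.2.2⟩

/-- **PUB⁴ ⟹ PUB⁵ (route ResidualThetaTransportAtTwo's copy of the same item)**.
[cite: SerreInventiones1972, §1.11 Prop. 12 (c),(d); §2.2] -/
theorem residualThetaTransport_of_esSdBzAu
    (hES : eichlerShimura_depletedOptimalQuotient_periodLattice_of_dvd) (hSD : heckeSelfDual_torsionBy_J0)
    (hBz : buzzard2000_multiplicityOne_gamma0)
    (hAU : abbesUllmo_not_dvd_maninConstant_of_not_dvd_level) :
    Summit.BirchSwinnertonDyer.BirchSwinnertonDyer.Theses.ResidualThetaTransportAtTwo.PublishedInputsHeckeAtTwo :=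
  ⟨hES, hSD, hBz, serre1972_supersingular_decompositionSubgroup_image_holds, hAU⟩

/-- **PUB⁵ ⟺ PUB⁴ (route ResidualThetaTransportAtTwo's copy)**.
[cite: SerreInventiones1972, §1.11 Prop. 12 (c),(d); §2.2] -/
theorem residualThetaTransport_iff_esSdBzAu :
    Summit.BirchSwinnertonDyer.BirchSwinnertonDyer.Theses.ResidualThetaTransportAtTwo.PublishedInputsHeckeAtTwo ↔
      eichlerShimura_depletedOptimalQuotient_periodLattice_of_dvd ∧ heckeSelfDual_torsionBy_J0 ∧
        buzzard2000_multiplicityOne_gamma0 ∧ abbesUllmo_not_dvd_maninConstant_of_not_dvd_level :=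
  ⟨fun h ↦ ⟨h.1, h.2.1, h.2.2.1, h.2.2.2.2⟩,
    fun h ↦ residualThetaTransport_of_esSdBzAu h.1 h.2.1 h.2.2.1 h.2.2.2⟩

-- Item stmt-BirchSwinnertonDyer-27793 (`SerreSupersingularDecompositionImageInput`, both routes' copies) is CLOSED·proved by the
-- already-landed by-name closers `Summit.BirchSwinnertonDyer.BirchSwinnertonDyer.Theorems.InputsSweep.thetaPartnerAtTwo_serreSupersingularDecompositionImageInput_proof`
-- and `…InputsSweep.residualThetaTransportAtTwo_serreSupersingularDecompositionImageInput_proof` (module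
-- `Theorems/ThetaPartnerAtTwoSerreSupersingularDecompositionImageInput.lean`, p646467); the author's two identical closers were removed
-- here at filing (gate `dedup.landed`), nothing else changed.

/-- The two routes' copies of the item are the same proposition. [folklore] -/
theorem thetaPartner_iff_residualThetaTransport :
    Summit.BirchSwinnertonDyer.BirchSwinnertonDyer.Theses.ThetaPartnerAtTwo.PublishedInputsHeckeAtTwo ↔
      Summit.BirchSwinnertonDyer.BirchSwinnertonDyer.Theses.ResidualThetaTransportAtTwo.PublishedInputsHeckeAtTwo :=
  Iff.rfl

end Summit.BirchSwinnertonDyer.BirchSwinnertonDyer.Theorems.PublishedInputsHeckeAtTwo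

end
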